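import Literature.MathematicalPhysics.QuantumFieldTheory.Federbush1986.NonAbelianDualityTheorem2
import Literature.MathematicalPhysics.QuantumFieldTheory.Federbush1986.NonAbelianDualitySU2Analytic
import Mathlib.Analysis.Normed.Group.Tannery

/-!
# `Federbush1986.NonAbelianDualityEq32` — [Federbush1987PhaseCellVI] **(32) p. 23**: «we need by virtue of the uniqueness in
# Theorem 1 study only the limit lim_{r→∞} lim_{s→∞} S^r_0({A(·, s)}) (32)» — the DOUBLE-LIMIT form of Theorem 2 PROVED for
# Federbush's scheme under the reader's typing binders of Theorems 1–2 (T-F6-1 chart, T-F6-2(b) BCH), and with NO hypothesis for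
# the concrete `SU(2)` scheme and the abelian `U(1)` model (theorems only)

statement-level skeleton of published theorems with citation tags; proofs where landed; nothing here is a claim about the Yang–Mills mass gap

CITATION HEADER.  P. Federbush, *A phase cell approach to Yang–Mills theory. VI. Non-abelian lattice-continuum duality*,
Ann. Inst. H. Poincaré (Physique théorique) **47** (1987) 17–23, Numdam `AIHPA_1987__47_1_17_0` [Federbush1987PhaseCellVI]
(cell paper F6; p. 23 READ AS IMAGE `run/shared/lean/pub/pub-balaban/b2b-balaban-t4-lit-g16/renders/federbushVI/1987-aihp47-
federbush-phase-cell-VI-nonabelian-duality-p007-x4.png`).  Unit `lit-balaban-r17` gen 6 (reader/typer r17 = F-fold owner);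
SKELETON row **F6.Eq32** of `run/shared/lean/pub/lit-balaban/lit-balaban-r17/SKELETON-r17.md` (Phase 1: `absent (proof
remark)`).  Inputs BY NAME: `theorem1_of_chart_tendsto` (`NonAbelianDualityTheorem1`, unit r17), `theorem2Oriented_of_chart`
(`NonAbelianDualityTheorem2`, unit r19), `absG_iterBlockSpin_le_of_chart`, `absG_plaqHol_le_sum`, `finite_plaq_norm_src_lt`,
`norm_cutoff_le_of_local` (`NonAbelianDualityCoarseSummable`, unit r19), `gApprox_congr_of_eqOn`, `cutoff`, `cutoff_eq_of_mem`,
`norm_segment_sub_src_le` (`NonAbelianDualityLocality`), `gApprox_eq_exp_of_le` (`NonAbelianDualityPlaquetteAction`),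
`norm_iterBlockSpinLog_logData_le_of_le` (`NonAbelianDualityPlaquetteCascade`), `iterBlockSpin_trans`, `tendsto_mul_seq`,
`tendsto_inv_seq` (`NonAbelianDualityEq12Proof`), `decay_package`, `polyEnvelope`, `integrable_polyEnvelope_sum_sq`
(`DecayEnvelope`, unit r17), `LatticeRiemann.summable_of_dominated`, `tsum_plaq_eq_tsum_base` (`LatticeActionLimit`, unit r17),
`chart_of_su2`, `bch_of_su2` (`NonAbelianDualitySU2`), `su2Scheme_continuousChoice_isFederbushSystem'`
(`NonAbelianDualitySU2Analytic`), `u1System_isFederbushSystem`, `u1System_chart`, `u1System_bch` (`NonAbelianDualityU1`), and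
Mathlib's Tannery theorem `tendsto_tsum_of_dominated_convergence`.  HOME `run/shared/lean/pub/lit-balaban/`.

WHAT IS PRINTED (p. 23, verbatim).  «We will not detail the proof of Theorem 2. The careful reader may be puzzled at the truth
of Theorem 2, when the estimate in (9) is not strong enough to ensure that two fields {g(e_α)} and {g₀(e_α, A_μ)} for e_α at
level r(α) have actions S^{r(α)}_0 close in value. But we need by virtue of the uniqueness in Theorem 1 study only the limit
lim_{r→∞} lim_{s→∞} S^r_0({A(·, s)}) (32) and the A(e, r₀) converge with better bounds as r₀ → ∞.»  Here `{A(·, s)}` is the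
level-`r` configuration of the `s`-approximates (11) («g(e, r₀) = g₀(e, A_μ) (11) for e in ℒ^{r₀} … the g(e, r₀) for all e with
level e < r₀ are then determined by the block spin transformations», p. 20: `gApprox A s r`), and `S^r_0` is the action (10)
(statement of record `latticeActionOriented`, `NonAbelianDuality` v5).

WHAT THIS MODULE TYPES AND PROVES.  The printed remark asserts that, for the family `g` associated to `A` (Theorem 1), the limit
of Theorem 2 may be computed as the ITERATED limit (32) over the approximates.  Its mathematical content is the exchange of the
inner limit `s → ∞` with the infinite plaquette sum of `ℒ^r`: (i) for every level `r` and all `s ≥ s(r)` the action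
`S^r_0({A(·, s)})` is a convergent plaquette sum; (ii) `S^r_0({A(·, s)}) → S^r_0(g(r))` as `s → ∞` — by uniqueness `g(r) =
lim_s g(·, s)(r)` edge by edge ((12), `theorem1_of_chart_tendsto`), and the exchange is dominated convergence (Tannery) with the
`s`-UNIFORM far-field envelope «the A(e, r₀) converge with better bounds»: `|g(f, s)| ≤ Q·B₁′(f)·ℓ_{r+k}` at a high auxiliary level
`r + k` for every LOCAL bound `B₁′(f)` of `|A_μ|` near `f` (`absG_gApprox_le_local`, the approximates of the cutoff potential in
logarithmic coordinates), iterated down `k` levels over the influence boxes (`absG_iterBlockSpin_le_of_chart`), whence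
`|g_∂p({A(·, s)})|² ≤ 16(c₀K(1 + (|x_p| − 17)₊)^{−(2+ε)})²` outside a finite set of plaquettes and `≤ D²` (`D` = the diameter of
the compact `G`) on it — a summable envelope independent of `s`; (iii) hence, with Theorem 2 (`theorem2Oriented_of_chart`),
`lim_{r→∞} lim_{s→∞} S^r_0({A(·, s)}) = ½∫(dA + A∧A)²` (32).  Binders: (i)–(ii) need only the chart binder `hchart` of T-F6-1
(as Theorem 1); (iii) also the BCH binder `hBCH` of T-F6-2(b) (as Theorem 2).  Both binders are THEOREMS for the concrete `SU(2)`
scheme `su2Scheme continuousChoice` and for the abelian model `u1System`, for which (32) is stated with no hypothesis (§5).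

Theorems only; no `def`, no `Prop` definition, no named fact; axioms standard.  §1 `absG_gApprox_le_local`; §2
`exists_absG_le_of_compact`, `src_add_single₃₂` (private), `plaqActionTermOriented_le_sq`, `norm_src_sub_le_of_mem_plaq`,
`plaqActionTermOriented_le_envelope`, `summable_indicator_near`, `summable_envelope_far`; §3 `tendsto_plaqHol_of_tendsto`,
`tendsto_plaqActionTermOriented_of_tendsto`, **`tendsto_latticeActionOriented_gApprox`**; §4 **`eq32_of_chart`**,
`eq32_double_limit_of_chart`; §5 `su2Scheme_continuousChoice_eq32`, `u1System_eq32`.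
-/

namespace Literature.MathematicalPhysics.QuantumFieldTheory.Federbush1986

noncomputable section

open Filter Metric Set MeasureTheory LatticeRiemann
open scoped Topology BigOperators

namespace BlockSpinSystem

variable (S : BlockSpinSystem)

/-! ## §1 «the A(e, r₀) converge with better bounds as r₀ → ∞»: the approximates are small far from the support of `A`,
UNIFORMLY in `r₀` -/

/-- **Far-field smallness of the approximates (11), uniformly in the top level**: for Federbush's scheme under the chart and a
`C¹` potential bounded by `B₁` there are `Q ≥ 0` and a level `s₅` such that for `s₅ < s ≤ n` and every edge `f` of `ℒ^s`,
`|g(f, n)| ≤ Q·B₁′·ℓ_s` for every bound `B₁′ ≥ 0` of `|A_μ|` on `closedBall x_f 10` (the approximates of the cutoff potential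
`χ_fA` agree with those of `A` at `f` by locality, and are exponentials of logarithmic block spins of size `≤ K₁B₁′ℓ_s`).
[cite: Federbush1987PhaseCellVI, (11)–(12) p. 20, (28) p. 22, (32) p. 23] -/
theorem absG_gApprox_le_local (hFS : S.IsFederbushSystem)
    (hchart : ∃ ρ > (0 : ℝ), ∃ C ≥ (1 : ℝ),
      (∀ X Y : S.𝔤, ‖X‖ < ρ → ‖Y‖ < ρ →
        C⁻¹ * ‖X - Y‖ ≤ dist (S.exp X) (S.exp Y) ∧ dist (S.exp X) (S.exp Y) ≤ C * ‖X - Y‖) ∧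
      ∀ g : S.G, absG g < ρ / C → ∃ X : S.𝔤, ‖X‖ < ρ ∧ S.exp X = g)
    (A : S.Potential) {B₁ : ℝ} (hB₁ : ∀ x μ, ‖A x μ‖ ≤ B₁) :
    ∃ Q : ℝ, 0 ≤ Q ∧ ∃ s₅ : ℕ, ∀ s, s₅ < s → ∀ n, s ≤ n → ∀ (f : Edge s) (B₁' : ℝ), 0 ≤ B₁' →
      (∀ y ∈ closedBall f.src 10, ∀ μ, ‖A y μ‖ ≤ B₁') → absG (S.gApprox A n s f) ≤ Q * B₁' * latLen s := by
  have hB₁0 : 0 ≤ B₁ := (norm_nonneg _).trans (hB₁ 0 0)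
  obtain ⟨ρ, hρ, C, hC1, hlip, -⟩ := hchart
  have hC0 : 0 < C := lt_of_lt_of_le one_pos hC1
  obtain ⟨K₁, hK₁, HK⟩ := S.norm_iterBlockSpinLog_logData_le_of_le hFS
  have hK₁0 : 0 ≤ K₁ := by linarith
  obtain ⟨s₁, Hs⟩ := HK B₁ hB₁0
  obtain ⟨s₄, Hrep⟩ := S.gApprox_eq_exp_of_le hFS B₁ hB₁0
  obtain ⟨sρ, Hρ⟩ := exists_latLen_lt (show 0 < ρ / (K₁ * B₁ + 1) by positivity)
  refine ⟨C * K₁, by positivity, max (max s₁ s₄) sρ, ?_⟩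
  intro s hs n hn f B₁' hB₁'0 hloc
  have hs₁ : s₁ < s := lt_of_le_of_lt ((le_max_left _ _).trans (le_max_left _ _)) hs
  have hs₄ : s₄ < s := lt_of_le_of_lt ((le_max_right _ _).trans (le_max_left _ _)) hs
  have hsρ : latLen s < ρ / (K₁ * B₁ + 1) := Hρ s ((le_max_right _ _).trans hs.le)
  have hℓ := latLen_pos s
  -- local bound below the global one, and the cutoff
  obtain ⟨m₁, hm₁def⟩ : ∃ m₁ : ℝ, m₁ = min B₁' B₁ := ⟨_, rfl⟩
  have hm₁0 : 0 ≤ m₁ := by rw [hm₁def]; exact le_min hB₁'0 hB₁0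
  have hm₁B : m₁ ≤ B₁ := by rw [hm₁def]; exact min_le_right _ _
  have hm₁B' : m₁ ≤ B₁' := by rw [hm₁def]; exact min_le_left _ _
  have hloc' : ∀ y ∈ closedBall f.src 10, ∀ μ, ‖A y μ‖ ≤ m₁ := fun y hy μ => by
    rw [hm₁def]; exact le_min (hloc y hy μ) (hB₁ y μ)
  have hA'b : ∀ y μ, ‖S.cutoff f.src 9 A y μ‖ ≤ m₁ := S.norm_cutoff_le_of_local f.src A hm₁0 hloc'
  have hEq : ∀ y ∈ closedBall f.src 9, S.cutoff f.src 9 A y = A y := fun y hy => S.cutoff_eq_of_mem A hy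
  -- the approximate of the cutoff: exp of a small logarithm
  have happ : absG (S.gApprox (S.cutoff f.src 9 A) n s f) ≤ C * K₁ * m₁ * latLen s := by
    have hsize := Hs (S.cutoff f.src 9 A) m₁ hA'b hm₁B n s hs₁ hn f
    have hsmall : ‖S.iterBlockSpinLog s n (S.logData (S.cutoff f.src 9 A) n) f‖ < ρ := by
      have h1 : K₁ * m₁ * latLen s ≤ (K₁ * B₁ + 1) * latLen s := by
        apply mul_le_mul_of_nonneg_right _ hℓ.le; nlinarith [mul_le_mul_of_nonneg_left hm₁B hK₁0]
      have h2 : (K₁ * B₁ + 1) * latLen s < ρ := by rw [lt_div_iff₀ (by positivity)] at hsρ; linarith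
      linarith
    rw [Hrep (S.cutoff f.src 9 A) m₁ hA'b hm₁B n s hs₄ hn f, absG, ← S.exp_zero hFS]
    have h := (hlip 0 _ (by simpa using hρ) hsmall).2
    rw [zero_sub, norm_neg] at h
    calc _ ≤ C * ‖S.iterBlockSpinLog s n (S.logData (S.cutoff f.src 9 A) n) f‖ := h
      _ ≤ C * (K₁ * m₁ * latLen s) := mul_le_mul_of_nonneg_left hsize hC0.le
      _ = C * K₁ * m₁ * latLen s := by ring
  -- it IS the approximate of A at f (locality)
  have hloc₂ : S.gApprox (S.cutoff f.src 9 A) n s f = S.gApprox A n s f := by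
    refine (S.gApprox_congr_of_eqOn hFS f (fun y hy => (hEq y ?_).symm) n).symm
    rw [mem_closedBall] at hy ⊢
    have := latLen_le_one s
    linarith
  rw [← hloc₂]
  calc absG (S.gApprox (S.cutoff f.src 9 A) n s f) ≤ C * K₁ * m₁ * latLen s := happ
    _ ≤ C * K₁ * B₁' * latLen s := by
        apply mul_le_mul_of_nonneg_right _ hℓ.le
        exact mul_le_mul_of_nonneg_left hm₁B' (by positivity)

/-! ## §2 An `s`-uniform summable envelope for the plaquette terms of `ℒ^r` -/

/-- On the compact group every `|g| = d(ε, g)` is bounded («a compact simple Lie group, G», p. 17).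
[cite: Federbush1987PhaseCellVI, p. 17–18, (6) p. 19] -/
theorem exists_absG_le_of_compact (hFS : S.IsFederbushSystem) : ∃ D : ℝ, 0 ≤ D ∧ ∀ g : S.G, absG g ≤ D := by
  haveI := hFS.compact
  obtain ⟨R, hR⟩ := (isBounded_iff_subset_closedBall (1 : S.G)).1 (isCompact_univ (X := S.G)).isBounded
  refine ⟨max R 0, le_max_right _ _, fun g => ?_⟩
  have hg : g ∈ closedBall (1 : S.G) R := hR (mem_univ g)
  rw [mem_closedBall, dist_comm] at hg
  exact (le_of_eq_of_le (absG_def g) hg).trans (le_max_left _ _)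

/-- The source of the edge at `b + e_i` is the source at `b` shifted by `ℓ_r e_i`. [cite: Federbush1986PhaseCellI, §1 p. 321] -/
private theorem src_add_single₃₂ {r : ℕ} (b : Fin 4 → ℤ) (i ν ν' : Fin 4) :
    (⟨b + Pi.single i 1, ν⟩ : Edge r).src = (⟨b, ν'⟩ : Edge r).src + latLen r • unitVec i := by
  simp only [Edge.src, mkPt, unitVec]
  rw [show (EuclideanSpace.single i (1 : ℝ) : E4) = WithLp.toLp 2 (Pi.single i (1 : ℝ)) from rfl,
    ← WithLp.toLp_smul, ← WithLp.toLp_add]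
  congr 1
  funext k
  rw [Pi.add_apply, Pi.add_apply, Pi.smul_apply, Pi.single_apply, Pi.single_apply]
  split_ifs <;> push_cast <;> ring

/-- The oriented plaquette term is at most `|g_∂p|² ≤ D²` for any bound `D` of `|·|` on `G`. [cite: Federbush1987PhaseCellVI, (10) p. 20] -/
theorem plaqActionTermOriented_le_sq {r : ℕ} (u : Edge r → S.G) (p : Plaq r) {D : ℝ} (hD : ∀ g : S.G, absG g ≤ D) :
    S.plaqActionTermOriented r u p ≤ D ^ 2 := by
  have hD0 : 0 ≤ D := (absG_nonneg (1 : S.G)).trans (hD 1)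
  unfold plaqActionTermOriented
  split_ifs
  · exact pow_le_pow_left₀ (absG_nonneg _) (hD _) 2
  · positivity

/-- The four edges of a plaquette have their sources within `ℓ_r ≤ 1` of its base vertex: `|x_p| − 17 ≤ |x_e| − 16`.
[cite: Federbush1987PhaseCellVI, (10) p. 20] -/
theorem norm_src_sub_le_of_mem_plaq {r : ℕ} (p : Plaq r) :
    ∀ e ∈ [(⟨p.base, p.dir₁⟩ : Edge r), ⟨p.base + Pi.single p.dir₁ 1, p.dir₂⟩,
      ⟨p.base + Pi.single p.dir₂ 1, p.dir₁⟩, ⟨p.base, p.dir₂⟩], ‖p.src‖ - 17 ≤ ‖e.src‖ - 16 := by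
  intro e he
  have hℓr := latLen_pos r
  have hℓr1 := latLen_le_one r
  have hu : ∀ i : Fin 4, ‖unitVec i‖ = 1 := fun i => by simp [unitVec]
  have key : ‖e.src - p.src‖ ≤ 1 := by
    simp only [List.mem_cons, List.mem_nil_iff, or_false] at he
    rcases he with rfl | rfl | rfl | rfl
    · rw [show (⟨p.base, p.dir₁⟩ : Edge r).src = p.src from rfl, sub_self, norm_zero]; exact zero_le_one
    · rw [src_add_single₃₂ p.base p.dir₁ p.dir₂ p.dir₁, show (⟨p.base, p.dir₁⟩ : Edge r).src = p.src from rfl,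
        add_sub_cancel_left, norm_smul, hu, mul_one, Real.norm_of_nonneg hℓr.le]; exact hℓr1
    · rw [src_add_single₃₂ p.base p.dir₂ p.dir₁ p.dir₁, show (⟨p.base, p.dir₁⟩ : Edge r).src = p.src from rfl,
        add_sub_cancel_left, norm_smul, hu, mul_one, Real.norm_of_nonneg hℓr.le]; exact hℓr1
    · rw [show (⟨p.base, p.dir₂⟩ : Edge r).src = p.src from rfl, sub_self, norm_zero]; exact zero_le_one
  have : ‖p.src‖ ≤ ‖e.src‖ + ‖e.src - p.src‖ := by
    calc ‖p.src‖ = ‖e.src - (e.src - p.src)‖ := by congr 1; abel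
      _ ≤ ‖e.src‖ + ‖e.src - p.src‖ := norm_sub_le _ _
  linarith

/-- **The envelope.** If every edge variable of `u ∈ ℱ^r` obeys the far-field bound `|u(e)| ≤ c₀ψ(t)` for all `t ≤ |x_e| − 16`
with `c₀ψ(t) ≤ η₀` (`ψ = polyEnvelope K q`), and `|·| ≤ D` on `G`, then for EVERY plaquette
`[dir₁ ≠ dir₂]|g_∂p(u)|² ≤ 16(c₀ψ(|x_p| − 17))² + [|x_p| < R₀ + 17]·D²`, `R₀` any radius beyond which `c₀ψ ≤ η₀`.
[cite: Federbush1987PhaseCellVI, (10) p. 20, (32) p. 23] -/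
theorem plaqActionTermOriented_le_envelope {r : ℕ} (u : Edge r → S.G) {K q c₀ η₀ D R₀ : ℝ}
    (hD : ∀ g : S.G, absG g ≤ D)
    (hedge : ∀ (e : Edge r) (t : ℝ), t ≤ ‖e.src‖ - 16 → c₀ * polyEnvelope K q t ≤ η₀ →
      absG (u e) ≤ c₀ * polyEnvelope K q t)
    (hR₀ : ∀ t, R₀ ≤ t → c₀ * polyEnvelope K q t ≤ η₀) (p : Plaq r) :
    S.plaqActionTermOriented r u p ≤
      16 * (c₀ * polyEnvelope K q (‖p.src‖ - 17)) ^ 2 + (if ‖p.src‖ < R₀ + 17 then D ^ 2 else 0) := by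
  have hD0 : 0 ≤ D := (absG_nonneg (1 : S.G)).trans (hD 1)
  by_cases hp : ‖p.src‖ < R₀ + 17
  · rw [if_pos hp]
    have h1 := S.plaqActionTermOriented_le_sq u p hD
    nlinarith [sq_nonneg (c₀ * polyEnvelope K q (‖p.src‖ - 17))]
  · rw [if_neg hp, add_zero]
    rw [not_lt] at hp
    have hcond : c₀ * polyEnvelope K q (‖p.src‖ - 17) ≤ η₀ := hR₀ _ (by linarith)
    have h := fun e he => hedge e (‖p.src‖ - 17) (norm_src_sub_le_of_mem_plaq p e he) hcond
    have h1 := h ⟨p.base, p.dir₁⟩ (by simp)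
    have h2 := h ⟨p.base + Pi.single p.dir₁ 1, p.dir₂⟩ (by simp)
    have h3 := h ⟨p.base + Pi.single p.dir₂ 1, p.dir₁⟩ (by simp)
    have h4 := h ⟨p.base, p.dir₂⟩ (by simp)
    have hplaq : absG (S.plaqHol u p) ≤ 4 * (c₀ * polyEnvelope K q (‖p.src‖ - 17)) := by
      calc absG (S.plaqHol u p) ≤ _ := S.absG_plaqHol_le_sum u p
        _ ≤ _ := by linarith
    have h0 : 0 ≤ absG (S.plaqHol u p) := absG_nonneg _
    unfold plaqActionTermOriented
    split_ifs
    · nlinarith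
    · positivity

/-- The near-field indicator part of the envelope is summable (finitely many plaquettes of `ℒ^r` have their base vertex in a
ball). [cite: Federbush1987PhaseCellVI, (10) p. 20] -/
theorem summable_indicator_near (r : ℕ) (R D : ℝ) :
    Summable fun p : Plaq r => (if ‖p.src‖ < R then D else 0 : ℝ) := by
  refine summable_of_hasFiniteSupport ((finite_plaq_norm_src_lt r R).subset fun p hp => ?_)
  simp only [Function.mem_support, ne_eq, ite_eq_right_iff, Classical.not_imp] at hp
  exact hp.1

/-- The far-field part of the envelope is summable over the plaquettes of `ℒ^r` (`2q > 4`: dominated by an integrable radial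
function of `ℝ⁴`, base-point sums by `LatticeRiemann.summable_of_dominated`). [cite: Federbush1987PhaseCellVI, (10) p. 20,
Theorem 2 p. 20] -/
theorem summable_envelope_far (r : ℕ) {K q : ℝ} (hK : 0 ≤ K) (hq : 2 < q) (c₀ : ℝ) :
    Summable fun p : Plaq r => 16 * (c₀ * polyEnvelope K q (‖p.src‖ - 17)) ^ 2 := by
  have hℓr := latLen_pos r
  have hq0 : 0 ≤ q := by linarith
  have henv_anti : Antitone (polyEnvelope K q) := polyEnvelope_antitone hK hq0
  have hbase : Summable fun b : Fin 4 → ℤ => ∑ μ : Fin 4, ∑ ν : Fin 4,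
      16 * (c₀ * polyEnvelope K q (‖(⟨b, μ, ν⟩ : Plaq r).src‖ - 17)) ^ 2 := by
    have hint : Integrable fun x : E4 => (polyEnvelope K q (‖x‖ - 19) + polyEnvelope 0 q (‖x‖ - 19)) ^ 2 :=
      integrable_polyEnvelope_sum_sq hK le_rfl hq (by norm_num) (by norm_num)
    refine LatticeRiemann.summable_of_dominated hℓr _ _ ((hint.const_mul (16 * (16 * c₀ ^ 2)))) fun x => ?_
    have hx : ‖x - cornerPt (latLen r) (floorIdx (latLen r) x)‖ ≤ 2 * latLen r := norm_sub_cornerPt_le hℓr x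
    have hℓr1 := latLen_le_one r
    have hsrc' : ∀ μ ν : Fin 4, (⟨floorIdx (latLen r) x, μ, ν⟩ : Plaq r).src = cornerPt (latLen r) (floorIdx (latLen r) x) :=
      fun μ ν => rfl
    have hmono : polyEnvelope K q (‖cornerPt (latLen r) (floorIdx (latLen r) x)‖ - 17) ≤ polyEnvelope K q (‖x‖ - 19) := by
      refine henv_anti ?_
      have : ‖x‖ ≤ ‖cornerPt (latLen r) (floorIdx (latLen r) x)‖ + ‖x - cornerPt (latLen r) (floorIdx (latLen r) x)‖ := by
        calc ‖x‖ = ‖cornerPt (latLen r) (floorIdx (latLen r) x) + (x - cornerPt (latLen r) (floorIdx (latLen r) x))‖ := by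
              congr 1; abel
          _ ≤ _ := norm_add_le _ _
      linarith
    have h0 : polyEnvelope 0 q (‖x‖ - 19) = 0 := by unfold polyEnvelope; ring
    have hp0 := polyEnvelope_nonneg hK q (‖cornerPt (latLen r) (floorIdx (latLen r) x)‖ - 17)
    have h1 : (c₀ * polyEnvelope K q (‖cornerPt (latLen r) (floorIdx (latLen r) x)‖ - 17)) ^ 2 ≤
        c₀ ^ 2 * polyEnvelope K q (‖x‖ - 19) ^ 2 := by
      rw [mul_pow]; exact mul_le_mul_of_nonneg_left (pow_le_pow_left₀ hp0 hmono 2) (sq_nonneg _)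
    rw [abs_of_nonneg (Finset.sum_nonneg fun μ _ => Finset.sum_nonneg fun ν _ => by positivity)]
    simp only [hsrc', Finset.sum_const, Finset.card_univ, Fintype.card_fin, nsmul_eq_mul, Nat.cast_ofNat, h0,
      add_zero]
    nlinarith [h1, sq_nonneg c₀]
  exact (tsum_plaq_eq_tsum_base (fun p : Plaq r => 16 * (c₀ * polyEnvelope K q (‖p.src‖ - 17)) ^ 2)
    (fun p => by positivity) hbase).1

/-! ## §3 The inner limit of (32): `S^r_0({A(·, s)}) → S^r_0(g(r))` as `s → ∞` -/

/-- The plaquette holonomy `g_∂p` is (sequentially) continuous in the edge variables (invariant metric).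
[cite: Federbush1987PhaseCellVI, (10) p. 20, p. 19] -/
theorem tendsto_plaqHol_of_tendsto {r : ℕ} {u : ℕ → Edge r → S.G} {u' : Edge r → S.G}
    (hu : ∀ e, Tendsto (fun n => u n e) atTop (𝓝 (u' e))) (p : Plaq r) :
    Tendsto (fun n => S.plaqHol (u n) p) atTop (𝓝 (S.plaqHol u' p)) := by
  unfold plaqHol
  exact S.tendsto_mul_seq (S.tendsto_mul_seq (S.tendsto_mul_seq (hu _) (hu _)) (S.tendsto_inv_seq (hu _)))
    (S.tendsto_inv_seq (hu _))

/-- The oriented plaquette term `[dir₁ ≠ dir₂]|g_∂p|²` is (sequentially) continuous in the edge variables.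
[cite: Federbush1987PhaseCellVI, (10) p. 20] -/
theorem tendsto_plaqActionTermOriented_of_tendsto {r : ℕ} {u : ℕ → Edge r → S.G} {u' : Edge r → S.G}
    (hu : ∀ e, Tendsto (fun n => u n e) atTop (𝓝 (u' e))) (p : Plaq r) :
    Tendsto (fun n => S.plaqActionTermOriented r (u n) p) atTop (𝓝 (S.plaqActionTermOriented r u' p)) := by
  unfold plaqActionTermOriented
  split_ifs
  · have hc : Continuous fun x : S.G => absG x ^ 2 := by unfold absG; fun_prop
    exact (hc.tendsto _).comp (S.tendsto_plaqHol_of_tendsto hu p)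
  · exact tendsto_const_nhds

/-- **The inner limit of (32).**  For Federbush's scheme under the chart (T-F6-1), a `C¹` potential with `|A_μ(x)| ≤ K(1 +
|x|)^{−q}`, `q > 2`, and its associated family `g` (Theorem 1): at every level `r`, the actions `S^r_0({A(·, s)})` of the
`s`-approximates (11) are convergent plaquette sums for all large `s`, and `S^r_0({A(·, s)}) → S^r_0(g(r))` as `s → ∞` —
«by virtue of the uniqueness in Theorem 1» (`g(r) = lim_s g(·, s)(r)` edge by edge) and «the A(e, r₀) converge with better
bounds» (the `s`-uniform summable envelope of §2, Tannery's theorem). [cite: Federbush1987PhaseCellVI, (32) p. 23, (10)–(12) p. 20,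
Theorem 1 p. 20] -/
theorem tendsto_latticeActionOriented_gApprox (hFS : S.IsFederbushSystem)
    (hchart : ∃ ρ > (0 : ℝ), ∃ C ≥ (1 : ℝ),
      (∀ X Y : S.𝔤, ‖X‖ < ρ → ‖Y‖ < ρ →
        C⁻¹ * ‖X - Y‖ ≤ dist (S.exp X) (S.exp Y) ∧ dist (S.exp X) (S.exp Y) ≤ C * ‖X - Y‖) ∧
      ∀ g : S.G, absG g < ρ / C → ∃ X : S.𝔤, ‖X‖ < ρ ∧ S.exp X = g)
    (A : S.Potential) (hA : ContDiff ℝ 1 A) {K q : ℝ} (hK : 0 ≤ K) (hq : 2 < q)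
    (hdec : ∀ x μ, ‖A x μ‖ ≤ K * (1 + ‖x‖) ^ (-q))
    {g : (r : ℕ) → Edge r → S.G} (hg : S.IsAssociated A g) (r : ℕ) :
    (∀ᶠ n in atTop, Summable (S.plaqActionTermOriented r (S.gApprox A n r))) ∧
      Tendsto (fun n => S.latticeActionOriented r (S.gApprox A n r)) atTop
        (𝓝 (S.latticeActionOriented r (g r))) := by
  have hq0 : 0 ≤ q := by linarith
  -- global bound
  have hB₁ : ∀ x μ, ‖A x μ‖ ≤ K := fun x μ => (hdec x μ).trans <| by
    have : (1 + ‖x‖) ^ (-q) ≤ 1 :=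
      Real.rpow_le_one_of_one_le_of_nonpos (by linarith [norm_nonneg x]) (by linarith)
    nlinarith
  obtain ⟨Θ, hΘ1, η₀, hη₀, Hit⟩ := S.absG_iterBlockSpin_le_of_chart hFS hchart
  have hΘ0 : 0 ≤ Θ := zero_le_one.trans hΘ1
  obtain ⟨Q, hQ, s₅, Hfar⟩ := S.absG_gApprox_le_local hFS hchart A hB₁
  obtain ⟨D, hD0, hD⟩ := S.exists_absG_le_of_compact hFS
  -- pointwise convergence: (12) and the uniqueness of Theorem 1
  obtain ⟨g', -, hlim, huniq⟩ := S.theorem1_of_chart_tendsto hchart hFS A hA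
  have hgg : g = g' := huniq g hg
  -- the auxiliary high level r + k above the small-field threshold
  obtain ⟨k, hk⟩ : ∃ k : ℕ, s₅ < r + k := ⟨s₅ + 1, by omega⟩
  have hℓr := latLen_pos r
  have hℓr1 := latLen_le_one r
  have hℓs := latLen_pos (r + k)
  have henv_anti : Antitone (polyEnvelope K q) := polyEnvelope_antitone hK hq0
  have hdec' : ∀ y μ, ‖A y μ‖ ≤ polyEnvelope K q ‖y‖ := fun y μ => by rw [polyEnvelope_norm]; exact hdec y μ
  -- far-field bound at the high level over the influence box of a level-r edge, UNIFORMLY in the top level n ≥ r + k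
  have hfarf : ∀ n, r + k ≤ n → ∀ (e : Edge r) (f : Edge (r + k)), inflBox e.base k f.base →
      absG (S.gApprox A n (r + k) f) ≤ Q * polyEnvelope K q (‖e.src‖ - 16) * latLen (r + k) := by
    intro n hn e f hf
    refine Hfar (r + k) hk n hn f _ (polyEnvelope_nonneg hK _ _) fun y hy μ => (hdec' y μ).trans (henv_anti ?_)
    have h1 : ‖f.src - e.src‖ ≤ 6 * latLen r := by
      have h := norm_segment_sub_src_le (Nat.le_add_right r k) e f (by simpa using hf) (t := 0)
        ⟨le_rfl, (latLen_pos _).le⟩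
      simpa using h
    rw [mem_closedBall, dist_eq_norm] at hy
    have h2 : ‖e.src‖ ≤ ‖y‖ + ‖y - f.src‖ + ‖f.src - e.src‖ := by
      calc ‖e.src‖ = ‖y - ((y - f.src) + (f.src - e.src))‖ := by congr 1; abel
        _ ≤ ‖y‖ + ‖(y - f.src) + (f.src - e.src)‖ := norm_sub_le _ _
        _ ≤ ‖y‖ + (‖y - f.src‖ + ‖f.src - e.src‖) := add_le_add le_rfl (norm_add_le _ _)
        _ = _ := by ring
    linarith
  -- the level-r approximates are the k-fold block spins of the level-(r + k) approximates
  have hgr : ∀ n, r + k ≤ n → S.gApprox A n r = S.iterBlockSpin r (r + k) (S.gApprox A n (r + k)) := by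
    intro n hn
    unfold gApprox
    exact S.iterBlockSpin_trans r (r + k) (Nat.le_add_right r k) (n - (r + k)) n (by omega) _
  obtain ⟨c₀, hc₀def⟩ : ∃ c₀ : ℝ, c₀ = Θ ^ k * Q * latLen (r + k) := ⟨_, rfl⟩
  have hc₀0 : 0 ≤ c₀ := by rw [hc₀def]; positivity
  have hedge' : ∀ n, r + k ≤ n → ∀ (e : Edge r) (t : ℝ), t ≤ ‖e.src‖ - 16 → c₀ * polyEnvelope K q t ≤ η₀ →
      absG (S.gApprox A n r e) ≤ c₀ * polyEnvelope K q t := by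
    intro n hn e t ht hcond
    have hmono : polyEnvelope K q (‖e.src‖ - 16) ≤ polyEnvelope K q t := henv_anti ht
    have h1 : Θ ^ k * (Q * polyEnvelope K q (‖e.src‖ - 16) * latLen (r + k)) = c₀ * polyEnvelope K q (‖e.src‖ - 16) := by
      rw [hc₀def]; ring
    have h2 : c₀ * polyEnvelope K q (‖e.src‖ - 16) ≤ c₀ * polyEnvelope K q t := mul_le_mul_of_nonneg_left hmono hc₀0
    have h3 : absG (S.gApprox A n r e) ≤ Θ ^ k * (Q * polyEnvelope K q (‖e.src‖ - 16) * latLen (r + k)) := by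
      rw [hgr n hn]
      exact Hit k r (S.gApprox A n (r + k)) e _ (by have := polyEnvelope_nonneg hK q (‖e.src‖ - 16); positivity)
        (hfarf n hn e) (by rw [h1]; exact h2.trans hcond)
    rw [h1] at h3
    exact h3.trans h2
  -- the far region: c₀ψ ≤ η₀ beyond a radius R₀
  have htend : Tendsto (fun t : ℝ => c₀ * polyEnvelope K q t) atTop (𝓝 0) := by
    have h1 : Tendsto (fun t : ℝ => 1 + max t 0) atTop atTop := by
      refine tendsto_atTop_add_const_left _ _ (tendsto_atTop_atTop.2 fun b => ⟨b, fun a ha => ha.trans (le_max_left _ _)⟩)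
    have h2 := (tendsto_rpow_neg_atTop (by linarith : (0 : ℝ) < q)).comp h1
    have h3 : Tendsto (fun t : ℝ => c₀ * (K * (1 + max t 0) ^ (-q))) atTop (𝓝 (c₀ * (K * 0))) :=
      (h2.const_mul K).const_mul c₀
    rw [mul_zero, mul_zero] at h3
    exact h3
  obtain ⟨R₀, hR₀⟩ : ∃ R₀ : ℝ, ∀ t, R₀ ≤ t → c₀ * polyEnvelope K q t ≤ η₀ := by
    obtain ⟨R₀, h⟩ := (htend.eventually (eventually_le_nhds hη₀)).exists_forall_of_atTop
    exact ⟨R₀, h⟩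
  -- the s-uniform summable envelope
  obtain ⟨bound, hbdef⟩ : ∃ bound : Plaq r → ℝ, bound = fun p => 16 * (c₀ * polyEnvelope K q (‖p.src‖ - 17)) ^ 2 +
      (if ‖p.src‖ < R₀ + 17 then D ^ 2 else 0) := ⟨_, rfl⟩
  have hsum : Summable bound := by
    rw [hbdef]
    exact (summable_envelope_far r hK hq c₀).add (summable_indicator_near r (R₀ + 17) (D ^ 2))
  have hdom : ∀ n, r + k ≤ n → ∀ p, S.plaqActionTermOriented r (S.gApprox A n r) p ≤ bound p := fun n hn p => by
    rw [hbdef]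
    exact S.plaqActionTermOriented_le_envelope (S.gApprox A n r) hD (hedge' n hn) hR₀ p
  have hev : ∀ᶠ n in atTop, ∀ p, ‖S.plaqActionTermOriented r (S.gApprox A n r) p‖ ≤ bound p :=
    eventually_atTop.2 ⟨r + k, fun n hn p => by
      rw [Real.norm_of_nonneg (S.plaqActionTermOriented_nonneg r _ p)]; exact hdom n hn p⟩
  refine ⟨eventually_atTop.2 ⟨r + k, fun n hn => ?_⟩, ?_⟩
  · exact Summable.of_nonneg_of_le (S.plaqActionTermOriented_nonneg r _) (hdom n hn) hsum
  · have hpt : ∀ p : Plaq r, Tendsto (fun n => S.plaqActionTermOriented r (S.gApprox A n r) p) atTop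
        (𝓝 (S.plaqActionTermOriented r (g r) p)) := fun p => by
      rw [hgg]; exact S.tendsto_plaqActionTermOriented_of_tendsto (fun e => hlim r e) p
    have h := tendsto_tsum_of_dominated_convergence hsum hpt hev
    unfold latticeActionOriented
    exact h.const_mul (1 / 4 : ℝ)

/-! ## §4 (32): `lim_{r→∞} lim_{s→∞} S^r_0({A(·, s)}) = ½∫(dA + A∧A)²` -/

/-- **(32) for the associated family.**  For Federbush's scheme under the typing binders of Theorems 1–2 (`hchart`, `hBCH`), a
`C¹` potential with the decay of Theorem 2, and its associated family `g`: (i) at every level `r` the actions of the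
`s`-approximates are convergent plaquette sums for all large `s`; (ii) `S^r_0({A(·, s)}) → S^r_0(g(r))` as `s → ∞`; (iii)
`lim_{r→∞} lim_{s→∞} S^r_0({A(·, s)}) = ½∫(dA + A∧A)²` — «we need by virtue of the uniqueness in Theorem 1 study only the limit
(32)». [cite: Federbush1987PhaseCellVI, (32) p. 23, Theorem 2 p. 20, Theorem 1 p. 20] -/
theorem eq32_of_chart
    (hchart : ∃ ρ > (0 : ℝ), ∃ C ≥ (1 : ℝ),
      (∀ X Y : S.𝔤, ‖X‖ < ρ → ‖Y‖ < ρ →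
        C⁻¹ * ‖X - Y‖ ≤ dist (S.exp X) (S.exp Y) ∧ dist (S.exp X) (S.exp Y) ≤ C * ‖X - Y‖) ∧
      ∀ g : S.G, absG g < ρ / C → ∃ X : S.𝔤, ‖X‖ < ρ ∧ S.exp X = g)
    (hBCH : ∃ ρ > (0 : ℝ), ∃ C : ℝ, ∀ X Y : S.𝔤, ‖X‖ < ρ → ‖Y‖ < ρ →
      dist (S.exp X * S.exp Y) (S.exp (X + Y + (1 / 2 : ℝ) • S.lie X Y)) ≤ C * (‖X‖ + ‖Y‖) ^ 3)
    (hFS : S.IsFederbushSystem) (A : S.Potential) (hA : ContDiff ℝ 1 A)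
    (hdecay : ∃ ε > (0 : ℝ), ∃ c : ℝ, ∀ x : E4, ∀ μ, ‖x‖ ^ (2 + ε) * ‖A x μ‖ < c ∧
        ∀ ν, ‖x‖ ^ (2 + ε) * ‖fderiv ℝ (fun y => A y μ) x (unitVec ν)‖ < c)
    {g : (r : ℕ) → Edge r → S.G} (hg : S.IsAssociated A g) :
    (∀ r, ∀ᶠ s in atTop, Summable (S.plaqActionTermOriented r (S.gApprox A s r))) ∧
      (∀ r, Tendsto (fun s => S.latticeActionOriented r (S.gApprox A s r)) atTop
        (𝓝 (S.latticeActionOriented r (g r)))) ∧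
      Tendsto (fun r => limUnder atTop (fun s => S.latticeActionOriented r (S.gApprox A s r))) atTop
        (𝓝 (S.contActionVI A)) := by
  obtain ⟨ε, hε, c, hdec⟩ := hdecay
  obtain ⟨K, hK, hA₁, -, -, -, -⟩ := decay_package hA hε hdec
  have hq : (2 : ℝ) < 2 + ε := by linarith
  have H := fun r => S.tendsto_latticeActionOriented_gApprox hFS hchart A hA hK hq hA₁ hg r
  refine ⟨fun r => (H r).1, fun r => (H r).2, ?_⟩
  have h2 := (S.theorem2Oriented_of_chart hchart hBCH hFS A hA ⟨ε, hε, c, hdec⟩ g hg).2.2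
  refine h2.congr' (Eventually.of_forall fun r => ?_)
  exact ((H r).2.limUnder_eq).symm

/-- **(32), print's form** (no reference to the associated family): under the same binders and hypotheses, every inner limit
`lim_{s→∞} S^r_0({A(·, s)})` exists and `lim_{r→∞} lim_{s→∞} S^r_0({A(·, s)}) = ½∫(dA + A∧A)²`.
[cite: Federbush1987PhaseCellVI, (32) p. 23, Theorem 2 p. 20] -/
theorem eq32_double_limit_of_chart
    (hchart : ∃ ρ > (0 : ℝ), ∃ C ≥ (1 : ℝ),
      (∀ X Y : S.𝔤, ‖X‖ < ρ → ‖Y‖ < ρ →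
        C⁻¹ * ‖X - Y‖ ≤ dist (S.exp X) (S.exp Y) ∧ dist (S.exp X) (S.exp Y) ≤ C * ‖X - Y‖) ∧
      ∀ g : S.G, absG g < ρ / C → ∃ X : S.𝔤, ‖X‖ < ρ ∧ S.exp X = g)
    (hBCH : ∃ ρ > (0 : ℝ), ∃ C : ℝ, ∀ X Y : S.𝔤, ‖X‖ < ρ → ‖Y‖ < ρ →
      dist (S.exp X * S.exp Y) (S.exp (X + Y + (1 / 2 : ℝ) • S.lie X Y)) ≤ C * (‖X‖ + ‖Y‖) ^ 3)
    (hFS : S.IsFederbushSystem) (A : S.Potential) (hA : ContDiff ℝ 1 A)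
    (hdecay : ∃ ε > (0 : ℝ), ∃ c : ℝ, ∀ x : E4, ∀ μ, ‖x‖ ^ (2 + ε) * ‖A x μ‖ < c ∧
        ∀ ν, ‖x‖ ^ (2 + ε) * ‖fderiv ℝ (fun y => A y μ) x (unitVec ν)‖ < c) :
    (∀ r, ∃ L : ℝ, Tendsto (fun s => S.latticeActionOriented r (S.gApprox A s r)) atTop (𝓝 L)) ∧
      Tendsto (fun r => limUnder atTop (fun s => S.latticeActionOriented r (S.gApprox A s r))) atTop
        (𝓝 (S.contActionVI A)) := by
  obtain ⟨g, hg, -, -⟩ := S.theorem1_of_chart_tendsto hchart hFS A hA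
  have H := S.eq32_of_chart hchart hBCH hFS A hA hdecay hg
  exact ⟨fun r => ⟨_, H.2.1 r⟩, H.2.2⟩

end BlockSpinSystem

/-! ## §5 (32) with NO hypothesis for the concrete `SU(2)` scheme and for the abelian model `U(1)` -/

/-- **(32) for Federbush's scheme on `G = SU(2)`** (`su2Scheme continuousChoice`: Federbush's words, the continuous admissible
block-spin function; `IsFederbushSystem`, the chart and the BCH binders are theorems for it): for every `C¹` potential with the
decay of Theorem 2, every inner limit `lim_s S^r_0({A(·, s)})` exists and `lim_r lim_s S^r_0({A(·, s)}) = ½∫(dA + A∧A)²`.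
[cite: Federbush1987PhaseCellVI, (32) p. 23, Theorem 2 p. 20] -/
theorem su2Scheme_continuousChoice_eq32
    (A : (su2Scheme SU2BlockSpinFunction.continuousChoice).Potential) (hA : ContDiff ℝ 1 A)
    (hdecay : ∃ ε > (0 : ℝ), ∃ c : ℝ, ∀ x : E4, ∀ μ, ‖x‖ ^ (2 + ε) * ‖A x μ‖ < c ∧
        ∀ ν, ‖x‖ ^ (2 + ε) * ‖fderiv ℝ (fun y => A y μ) x (unitVec ν)‖ < c) :
    (∀ r, ∃ L : ℝ, Tendsto (fun s => (su2Scheme SU2BlockSpinFunction.continuousChoice).latticeActionOriented r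
        ((su2Scheme SU2BlockSpinFunction.continuousChoice).gApprox A s r)) atTop (𝓝 L)) ∧
      Tendsto (fun r => limUnder atTop (fun s => (su2Scheme SU2BlockSpinFunction.continuousChoice).latticeActionOriented r
        ((su2Scheme SU2BlockSpinFunction.continuousChoice).gApprox A s r))) atTop
        (𝓝 ((su2Scheme SU2BlockSpinFunction.continuousChoice).contActionVI A)) :=
  (su2Scheme SU2BlockSpinFunction.continuousChoice).eq32_double_limit_of_chart
    ((su2Scheme SU2BlockSpinFunction.continuousChoice).chart_of_su2 (MulEquiv.refl SU2) (LinearIsometryEquiv.refl ℝ su2)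
      (fun _ _ => rfl) (fun _ => rfl))
    ((su2Scheme SU2BlockSpinFunction.continuousChoice).bch_of_su2 (MulEquiv.refl SU2) (LinearIsometryEquiv.refl ℝ su2)
      (fun _ _ => rfl) (fun _ => rfl) (fun _ _ => rfl))
    su2Scheme_continuousChoice_isFederbushSystem' A hA hdecay

/-- **(32) for the abelian model `G = U(1)`** (`u1System`; there `A ∧ A = 0` and (32) is the double-limit form of I §4's
lattice-continuum duality): every inner limit exists and `lim_r lim_s S^r_0({A(·, s)}) = ½∫(dA)²`.
[cite: Federbush1987PhaseCellVI, (32) p. 23, Theorem 2 p. 20; Federbush1986PhaseCellI, §4 p. 329] -/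
theorem u1System_eq32 (A : u1System.Potential) (hA : ContDiff ℝ 1 A)
    (hdecay : ∃ ε > (0 : ℝ), ∃ c : ℝ, ∀ x : E4, ∀ μ, ‖x‖ ^ (2 + ε) * ‖A x μ‖ < c ∧
        ∀ ν, ‖x‖ ^ (2 + ε) * ‖fderiv ℝ (fun y => A y μ) x (unitVec ν)‖ < c) :
    (∀ r, ∃ L : ℝ, Tendsto (fun s => u1System.latticeActionOriented r (u1System.gApprox A s r)) atTop (𝓝 L)) ∧
      Tendsto (fun r => limUnder atTop (fun s => u1System.latticeActionOriented r (u1System.gApprox A s r))) atTop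
        (𝓝 (u1System.contActionVI A)) :=
  u1System.eq32_double_limit_of_chart u1System_chart u1System_bch u1System_isFederbushSystem A hA hdecay

end

end Literature.MathematicalPhysics.QuantumFieldTheory.Federbush1986
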